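import Mathlib.Analysis.SpecialFunctions.PolarCoord
import Mathlib.Analysis.SpecialFunctions.Integrals.Basic
import Mathlib.Analysis.SpecialFunctions.Pow.Deriv
import Mathlib.Analysis.SpecialFunctions.Trigonometric.Bounds
import Mathlib.Analysis.SpecialFunctions.Log.Basic
import Mathlib.Analysis.Convex.Deriv
import Mathlib.Analysis.Convex.Mul
import Mathlib.Analysis.Convex.Jensen
import Mathlib.MeasureTheory.Function.Jacobian
import Mathlib.NumberTheory.Harmonic.Bounds
import Mathlib.Data.ZMod.ValMinAbs
import Literature.MathematicalPhysics.QuantumLattice.XYOrderProofs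
import HarnessLib

/-!
# Kennedy–Lieb–Shastry, XY model: the lattice integral and the Riemann sums (facts (E), (R''))

Trunk T-QLATTICE; sibling proof file of `XYOrderProofs.lean` (item
`provefact-Literature.Hubbard.kennedy_lieb_shastry_xy_ground`). No statement is introduced or changed.
This file supplies, with complete proofs, the *analytic* inputs of the Kennedy–Lieb–Shastry proof
of ground-state long-range order in the quantum XY model [KLS1988PRL]:

* `klsIntegral_two_le_holds : klsIntegral_two_le` — fact **(E)**, `I(2) ≤ 7/10`. The source
  reports the numerical value `I(2) = 0.65` (Kennedy–Lieb–Shastry 1988, after eq. (8)); we prove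
  analytically `∫_{[-π,π]²} F₂ ≤ 6√2π`, i.e. `I(2) ≤ 3√2/(2π) = 0.6752…`
  (`lintegral_klsIntegrand_two_le`): the half-angle substitution `s = sin(a/2), t = sin(b/2)`
  (change of variables `lintegral_image_eq_lintegral_abs_det_fderiv_mul`) turns
  `x = ½(cos a + cos b)` into `1 - s² - t²` and `da db` into `4 ds dt/√((1-s²)(1-t²))`; on the
  disc `s² + t² < 1` (where `x > 0`) one has `(1-s²)(1-t²) ≥ 1 - s² - t²`, so the integrand is at
  most `4 √(x(1+x))/(1-x) · … = 4√((1-r²)(2-r²))/r ≤ 4√2 (1 - ¾r²)/r` (AM–GM) in polar coordinates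
  (`lintegral_comp_polarCoord_symm`), and `2π ∫₀¹ 4√2(1 - ¾r²) dr = 6√2π`.
* `klsRiemannSum_eventually_le` — the hypothesis of
  `kennedy_lieb_shastry_xy_ground_of_riemannSum_le`: for every `d ≥ 2` there is `ρ < 1/√2`
  (`ρ = 0.69`) with `R_L(d) ≤ ρ` for all large `L`, where `R_L(d) = L^{-d} Σ_{k ≠ 0} F_d(2πk/L)`
  is the punctured Riemann sum of the KLS integrand. Quantitatively (`klsRiemannSum_le`)
  `R_L(d) ≤ 3√2/(2π) + d(d-1)√d (1 + log L)/L` for every `L ≥ 1`. This is the finite-volume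
  content of three steps of the source: "passing from sums to integrals" (before eq. (2)), the
  convexity bound `I(d) ≤ I(2)` and the value of `I(2)` (after eq. (8)). The proof:
  - `F_d(p) = G(d⁻¹ Σᵢ cos pᵢ)` with `G(y) = √((1+y)/(1-y)) y₊` nondecreasing and convex on
    `[-1, 1)` (`convexOn_klsG`: `G = φ ∘ (·)₊`, `φ(y) = (y + y²)(1 - y²)^{-1/2}` a product of
    nonnegative monotone convex functions, KLS's "`F(x) = x[(1+x)/(1-x)]^{1/2}` is an increasing
    convex function");
  - *interior points* (all `kᵢ ≠ 0`): discrete Jensen over ordered pairs of directions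
    (`klsG_avg_le`), the counting identity `Σ_{k : kᵢ, kⱼ ≠ 0} f(kᵢ, kⱼ) = L^{d-2} Σ_{a,b ≠ 0} f(a,b)`
    (`sum_pi_apply_two`) and the **two-dimensional cell bound** `Σ_{a,b ≠ 0} F₂(2πa/L, 2πb/L)
    ≤ (L/2π)² ∫_{[-π,π]²} F₂ ≤ (3√2/2π) L²` (`kls_twoDim_sum_le`): each lattice value times the
    cell area is below the integral over the cell *toward the origin* (signed representatives
    `valMinAbs`, `F₂` is monotone in the cosines), and these cells are disjoint
    (`lintegral_biUnion_finset`);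
  - *boundary points* (some `kᵢ = 0`, `k ≠ 0`): `F_d(p_k) ≤ √d L/(2|m_j|)` for any nonzero
    coordinate (`1 - cos x ≥ 2x²/π²`, Mathlib `Real.cos_le_one_sub_mul_cos_sq`), there are at most
    `d(d-1) L^{d-2}` such points per value of the nonzero coordinate, and
    `Σ_{b ≠ 0} 1/|valMinAbs b| ≤ 2 H_L ≤ 2(1 + log L)` (Mathlib `harmonic_le_one_add_log`).
  Neither the convergence `R_L → I(d)` (fact (R)) nor (M) as an inequality between integrals is
  needed in this form, and neither is used.

## References
* [KLS1988PRL] T. Kennedy, E. H. Lieb, B. S. Shastry, *The XY model has long-range order for all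
  spins and all dimensions greater than one*, Phys. Rev. Lett. 61 (1988) 2582–2584, eq. (8) and
  the paragraph following it.
* [DLS1978] F. J. Dyson, E. H. Lieb, B. Simon, J. Stat. Phys. 18 (1978) 335–383, §3 (sums versus
  integrals for infrared bounds).
-/

noncomputable section

open MeasureTheory Set Filter Topology
open scoped ENNReal
open Literature.MathematicalPhysics.QuantumLattice Literature.Probability.LatticeModels

namespace Literature.MathematicalPhysics.QuantumLattice

section Hubbard

/-! ### (E) Pointwise analysis of the two-dimensional KLS integrand -/

section IntegralE

/-- The KLS integrand in two variables: with `x = ½(cos a + cos b)`,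
`F₂(a,b) = √((1+x)/(1-x)) · x₊`. [Kennedy–Lieb–Shastry 1988, eq. (8)] [folklore] -/
theorem klsIntegrand_two (a b : ℝ) :
    klsIntegrand 2 ![a, b] =
      Real.sqrt ((1 + (Real.cos a + Real.cos b) / 2) / (1 - (Real.cos a + Real.cos b) / 2)) *
        max ((Real.cos a + Real.cos b) / 2) 0 := by
  rw [klsIntegrand, Fin.sum_univ_two, Fin.sum_univ_two, Fin.sum_univ_two]
  simp only [Matrix.cons_val_zero, Matrix.cons_val_one, Nat.cast_ofNat]
  congr 2
  rw [show (1 : ℝ) + Real.cos a + (1 + Real.cos b) = 2 * (1 + (Real.cos a + Real.cos b) / 2) by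
    ring, show (1 : ℝ) - Real.cos a + (1 - Real.cos b) = 2 * (1 - (Real.cos a + Real.cos b) / 2) by
    ring, mul_div_mul_left _ _ two_ne_zero]

/-- The half-angle substitution: `½(cos a + cos b) = 1 - sin²(a/2) - sin²(b/2)`. [folklore] -/
theorem half_cos_add_cos_eq (a b : ℝ) :
    (Real.cos a + Real.cos b) / 2 = 1 - Real.sin (a / 2) ^ 2 - Real.sin (b / 2) ^ 2 := by
  rw [Real.sin_sq_eq_half_sub, Real.sin_sq_eq_half_sub, show 2 * (a / 2) = a by ring,
    show 2 * (b / 2) = b by ring]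
  ring

/-- **The key pointwise inequality** (E): for `0 < s² + t² < 1` and `y = 1 - s² - t²`,
`4 y √((1+y)/(1-y)) / (√(1-s²) √(1-t²)) ≤ 4√2 (1 - ¾(s²+t²)) / √(s²+t²)`, from
`(1-s²)(1-t²) ≥ 1 - s² - t²` and the AM–GM step `√((1-r²)(2-r²)) ≤ √2 (1 - ¾ r²)`.
[Kennedy–Lieb–Shastry 1988, the value `I(2) = 0.65` (here: an analytic majorant)] [folklore] -/
theorem kls_substituted_integrand_le {s t : ℝ} (h0 : 0 < s ^ 2 + t ^ 2) (h1 : s ^ 2 + t ^ 2 < 1) :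
    4 * ((1 - s ^ 2 - t ^ 2) * Real.sqrt ((1 + (1 - s ^ 2 - t ^ 2)) / (1 - (1 - s ^ 2 - t ^ 2)))) /
        (Real.sqrt (1 - s ^ 2) * Real.sqrt (1 - t ^ 2)) ≤
      4 * Real.sqrt 2 * (1 - 3 / 4 * (s ^ 2 + t ^ 2)) / Real.sqrt (s ^ 2 + t ^ 2) := by
  set u := s ^ 2 + t ^ 2 with hu
  have hs2 : s ^ 2 < 1 := by nlinarith [sq_nonneg t]
  have ht2 : t ^ 2 < 1 := by nlinarith [sq_nonneg s]
  have hprod : 1 - u ≤ (1 - s ^ 2) * (1 - t ^ 2) := by nlinarith [sq_nonneg s, sq_nonneg t]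
  have hprod_pos : 0 < (1 - s ^ 2) * (1 - t ^ 2) := mul_pos (by linarith) (by linarith)
  -- rewrite both sides as square roots of explicit nonnegative quantities
  have hL : 4 * ((1 - s ^ 2 - t ^ 2) *
      Real.sqrt ((1 + (1 - s ^ 2 - t ^ 2)) / (1 - (1 - s ^ 2 - t ^ 2)))) /
        (Real.sqrt (1 - s ^ 2) * Real.sqrt (1 - t ^ 2)) =
      Real.sqrt (16 * (1 - u) ^ 2 * (2 - u) / (u * ((1 - s ^ 2) * (1 - t ^ 2)))) := by
    rw [← Real.sqrt_mul (by linarith : (0 : ℝ) ≤ 1 - s ^ 2), show (1 : ℝ) - s ^ 2 - t ^ 2 = 1 - u by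
      rw [hu]; ring, show (1 : ℝ) + (1 - u) = 2 - u by ring, show (1 : ℝ) - (1 - u) = u by ring]
    rw [show 4 * ((1 - u) * Real.sqrt ((2 - u) / u)) = Real.sqrt ((4 * (1 - u)) ^ 2 * ((2 - u) / u))
      by rw [Real.sqrt_mul (sq_nonneg _), Real.sqrt_sq (by linarith)]; ring, ← Real.sqrt_div']
    · congr 1
      field_simp
      ring
    · exact hprod_pos.le
  have hR : 4 * Real.sqrt 2 * (1 - 3 / 4 * u) / Real.sqrt u =
      Real.sqrt (32 * (1 - 3 / 4 * u) ^ 2 / u) := by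
    rw [show 4 * Real.sqrt 2 * (1 - 3 / 4 * u) = Real.sqrt ((4 * (1 - 3 / 4 * u)) ^ 2 * 2) by
      rw [Real.sqrt_mul (sq_nonneg _), Real.sqrt_sq (by linarith)]; ring, ← Real.sqrt_div']
    · congr 1
      field_simp
      ring
    · exact h0.le
  rw [hL, hR]
  refine Real.sqrt_le_sqrt ?_
  rw [div_le_div_iff₀ (mul_pos h0 hprod_pos) h0]
  -- `16 (1-u)² (2-u) u ≤ 32 (1 - ¾u)² (1-s²)(1-t²) u`, from `1 - u ≤ (1-s²)(1-t²)` and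
  -- `(1-u)(2-u) ≤ 2 (1 - ¾u)²`
  have hkey : (1 - u) * (2 - u) ≤ 2 * (1 - 3 / 4 * u) ^ 2 := by nlinarith [sq_nonneg u]
  have h1u : 0 ≤ 1 - u := by linarith
  calc 16 * (1 - u) ^ 2 * (2 - u) * u = 16 * (1 - u) * u * ((1 - u) * (2 - u)) := by ring
    _ ≤ 16 * ((1 - s ^ 2) * (1 - t ^ 2)) * u * (2 * (1 - 3 / 4 * u) ^ 2) :=
        mul_le_mul (mul_le_mul_of_nonneg_right (mul_le_mul_of_nonneg_left hprod (by norm_num))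
          h0.le) hkey (by nlinarith) (by positivity)
    _ = 32 * (1 - 3 / 4 * u) ^ 2 * (u * ((1 - s ^ 2) * (1 - t ^ 2))) := by ring

/-! ### (E) The integral: half-angle substitution, polar coordinates, and `I(2) ≤ 3√2/(2π)` -/

/-- The KLS integrand is measurable. [folklore] -/
theorem measurable_klsIntegrand (ν : ℕ) : Measurable (klsIntegrand ν) := by
  unfold klsIntegrand
  refine Measurable.mul (Real.continuous_sqrt.measurable.comp ?_) ?_
  · exact (Finset.measurable_sum _ fun i _ =>
      measurable_const.add (Real.measurable_cos.comp (measurable_pi_apply i))).div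
      (Finset.measurable_sum _ fun i _ =>
        measurable_const.sub (Real.measurable_cos.comp (measurable_pi_apply i)))
  · exact ((Finset.measurable_sum _ fun i _ =>
      Real.measurable_cos.comp (measurable_pi_apply i)).div_const _).max measurable_const

/-- The derivative of the half-angle sine. [folklore] -/
theorem hasDerivAt_sin_half (a : ℝ) :
    HasDerivAt (fun a : ℝ => Real.sin (a / 2)) (Real.cos (a / 2) / 2) a := by
  have h := ((hasDerivAt_id a).div_const 2).sin
  simp only [id] at h
  convert h using 1
  ring

/-- The half-angle sine is injective on `(-π, π)`. [folklore] -/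
theorem injOn_sin_half : InjOn (fun a : ℝ => Real.sin (a / 2)) (Ioo (-Real.pi) Real.pi) := by
  intro a ha b hb h
  have ha' : a / 2 ∈ Icc (-(Real.pi / 2)) (Real.pi / 2) := ⟨by linarith [ha.1], by linarith [ha.2]⟩
  have hb' : b / 2 ∈ Icc (-(Real.pi / 2)) (Real.pi / 2) := ⟨by linarith [hb.1], by linarith [hb.2]⟩
  have := Real.injOn_sin ha' hb' h
  linarith

/-- The determinant of the diagonal derivative `(h₁, h₂) ↦ (c h₁, d h₂)`. [folklore] -/
theorem det_toSpanSingleton_prodMap (c d : ℝ) :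
    ((ContinuousLinearMap.toSpanSingleton ℝ c).prodMap
      (ContinuousLinearMap.toSpanSingleton ℝ d) : ℝ × ℝ →L[ℝ] ℝ × ℝ).det = c * d := by
  have h : ∀ a : ℝ, ((ContinuousLinearMap.toSpanSingleton ℝ a : ℝ →L[ℝ] ℝ) : ℝ →ₗ[ℝ] ℝ) =
      a • LinearMap.id := fun a => by apply LinearMap.ext_ring; simp
  rw [ContinuousLinearMap.det, ContinuousLinearMap.coe_prodMap, LinearMap.det_prodMap, h, h,
    LinearMap.det_smul, LinearMap.det_smul, LinearMap.det_id, Module.finrank_self]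
  ring

/-- **The substituted integral is at most `6√2 π`**:
`∫_{[-π,π]²} F₂ ≤ 6√2π` (as a Lebesgue integral), by the half-angle substitution
`(a,b) ↦ (sin(a/2), sin(b/2))` (Mathlib's change-of-variables formula
`lintegral_image_eq_lintegral_abs_det_fderiv_mul`), the pointwise bound
`kls_substituted_integrand_le`, and polar coordinates (`lintegral_comp_polarCoord_symm`):
`∫∫_{disc} 4√2 (1 - ¾r²)/r ds dt = 2π · 4√2 · ∫₀¹ (1 - ¾r²) dr = 6√2π`.
[Kennedy–Lieb–Shastry 1988, the value of `I(2)`] [folklore] -/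
theorem lintegral_klsIntegrand_two_le :
    ∫⁻ p in Set.pi univ (fun _ : Fin 2 => Icc (-Real.pi) Real.pi), ENNReal.ofReal (klsIntegrand 2 p)
      ≤ ENNReal.ofReal (6 * Real.sqrt 2 * Real.pi) := by
  -- (a) closed box → open box
  have hae : (Set.pi univ fun _ : Fin 2 => Ioo (-Real.pi) Real.pi) =ᵐ[volume]
      (Set.pi univ fun _ : Fin 2 => Icc (-Real.pi) Real.pi) := by
    have h := Measure.pi_Ioo_ae_eq_pi_Icc (μ := fun _ : Fin 2 => (volume : Measure ℝ)) (s := univ)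
      (f := fun _ => -Real.pi) (g := fun _ => Real.pi)
    rw [← volume_pi] at h
    exact h
  rw [← setLIntegral_congr hae]
  -- (b) transport to `ℝ × ℝ`
  set S₂ : Set (ℝ × ℝ) := Ioo (-Real.pi) Real.pi ×ˢ Ioo (-Real.pi) Real.pi with hS₂
  have hS₂m : MeasurableSet S₂ := measurableSet_Ioo.prod measurableSet_Ioo
  set Φ : ℝ × ℝ → ℝ≥0∞ := fun q => ENNReal.ofReal (klsIntegrand 2 ![q.1, q.2]) with hΦ
  have hpre : (MeasurableEquiv.finTwoArrow : (Fin 2 → ℝ) ≃ᵐ ℝ × ℝ) ⁻¹' S₂ =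
      Set.pi univ fun _ : Fin 2 => Ioo (-Real.pi) Real.pi := by
    ext v
    simp [hS₂, MeasurableEquiv.finTwoArrow_apply, Fin.forall_fin_two]
  have hb : ∫⁻ v in Set.pi univ (fun _ : Fin 2 => Ioo (-Real.pi) Real.pi),
      ENNReal.ofReal (klsIntegrand 2 v) = ∫⁻ q in S₂, Φ q := by
    rw [← hpre, ← (volume_preserving_finTwoArrow ℝ).setLIntegral_comp_preimage_emb
      (MeasurableEquiv.finTwoArrow).measurableEmbedding Φ S₂]
    refine lintegral_congr fun v => ?_
    simp only [hΦ, MeasurableEquiv.finTwoArrow_apply]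
    congr 2
    ext i
    fin_cases i <;> rfl
  rw [hb]
  -- (c) change of variables on `S₂`
  set ψ : ℝ × ℝ → ℝ × ℝ := fun q => (Real.sin (q.1 / 2), Real.sin (q.2 / 2)) with hψ
  set ψ' : ℝ × ℝ → (ℝ × ℝ →L[ℝ] ℝ × ℝ) := fun q =>
    (ContinuousLinearMap.toSpanSingleton ℝ (Real.cos (q.1 / 2) / 2)).prodMap
      (ContinuousLinearMap.toSpanSingleton ℝ (Real.cos (q.2 / 2) / 2)) with hψ'
  have hderiv : ∀ q ∈ S₂, HasFDerivWithinAt ψ (ψ' q) S₂ q := fun q _ =>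
    (HasFDerivAt.prodMap (p := q) (hasDerivAt_sin_half q.1).hasFDerivAt
      (hasDerivAt_sin_half q.2).hasFDerivAt).hasFDerivWithinAt
  have hinj : InjOn ψ S₂ := injOn_sin_half.prodMap injOn_sin_half
  set g : ℝ × ℝ → ℝ≥0∞ := fun w => ENNReal.ofReal (4 * (max (1 - w.1 ^ 2 - w.2 ^ 2) 0 *
    Real.sqrt ((1 + (1 - w.1 ^ 2 - w.2 ^ 2)) / (1 - (1 - w.1 ^ 2 - w.2 ^ 2)))) /
      (Real.sqrt (1 - w.1 ^ 2) * Real.sqrt (1 - w.2 ^ 2))) with hg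
  have hpt : EqOn Φ (fun q => ENNReal.ofReal |(ψ' q).det| * g (ψ q)) S₂ := by
    rintro ⟨a, b⟩ ⟨ha, hb⟩
    have hca : 0 < Real.cos (a / 2) := Real.cos_pos_of_mem_Ioo ⟨by linarith [ha.1], by linarith [ha.2]⟩
    have hcb : 0 < Real.cos (b / 2) := Real.cos_pos_of_mem_Ioo ⟨by linarith [hb.1], by linarith [hb.2]⟩
    have hsa : Real.sqrt (1 - Real.sin (a / 2) ^ 2) = Real.cos (a / 2) :=
      (Real.cos_eq_sqrt_one_sub_sin_sq (by linarith [ha.1]) (by linarith [ha.2])).symm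
    have hsb : Real.sqrt (1 - Real.sin (b / 2) ^ 2) = Real.cos (b / 2) :=
      (Real.cos_eq_sqrt_one_sub_sin_sq (by linarith [hb.1]) (by linarith [hb.2])).symm
    simp only [hΦ, hg, hψ, hψ', det_toSpanSingleton_prodMap]
    rw [klsIntegrand_two, half_cos_add_cos_eq, hsa, hsb,
      abs_of_pos (mul_pos (half_pos hca) (half_pos hcb)), ← ENNReal.ofReal_mul (by positivity)]
    congr 1
    field_simp
    ring
  have hc : ∫⁻ q in S₂, Φ q = ∫⁻ w in ψ '' S₂, g w := by
    rw [lintegral_image_eq_lintegral_abs_det_fderiv_mul volume hS₂m hderiv hinj g]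
    exact setLIntegral_congr_fun hS₂m hpt
  rw [hc]
  refine (setLIntegral_le_lintegral _ _).trans ?_
  -- (d) the radial majorant
  set h : ℝ × ℝ → ℝ≥0∞ := fun w => ENNReal.ofReal (if w.1 ^ 2 + w.2 ^ 2 < 1 then
    4 * Real.sqrt 2 * (1 - 3 / 4 * (w.1 ^ 2 + w.2 ^ 2)) / Real.sqrt (w.1 ^ 2 + w.2 ^ 2) else 0)
    with hh
  have hgh : g ≤ h := by
    rintro ⟨s, t⟩
    simp only [hg, hh]
    by_cases hlt : s ^ 2 + t ^ 2 < 1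
    · rw [if_pos hlt]
      rcases (show 0 ≤ s ^ 2 + t ^ 2 by positivity).eq_or_lt with h0 | h0
      · -- the origin: both sides are (junk) `0`
        have hs : s = 0 := by nlinarith [sq_nonneg s, sq_nonneg t]
        have ht : t = 0 := by nlinarith [sq_nonneg s, sq_nonneg t]
        subst hs; subst ht
        norm_num
      · rw [max_eq_left (by linarith)]
        exact ENNReal.ofReal_le_ofReal (kls_substituted_integrand_le h0 hlt)
    · rw [if_neg hlt, max_eq_right (by linarith), ENNReal.ofReal_zero]
      simp
  refine (lintegral_mono hgh).trans ?_
  -- (e) polar coordinates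
  rw [← lintegral_comp_polarCoord_symm h]
  set φ : ℝ → ℝ≥0∞ := fun r => ENNReal.ofReal (4 * Real.sqrt 2 * (1 - 3 / 4 * r ^ 2)) with hφ
  have hpolar : EqOn (fun p : ℝ × ℝ => ENNReal.ofReal p.1 • h (polarCoord.symm p))
      (fun p => (Ioo (0 : ℝ) 1).indicator φ p.1 * 1) polarCoord.target := by
    rintro ⟨r, θ⟩ ⟨hr, -⟩
    simp only [Set.mem_Ioi] at hr
    have hr2 : (r * Real.cos θ) ^ 2 + (r * Real.sin θ) ^ 2 = r ^ 2 := by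
      nlinarith [Real.sin_sq_add_cos_sq θ]
    simp only [hh, polarCoord_symm_apply, hr2, smul_eq_mul, mul_one, Real.sqrt_sq hr.le]
    by_cases h1 : r < 1
    · rw [if_pos (by nlinarith), Set.indicator_of_mem (show r ∈ Set.Ioo (0 : ℝ) 1 from ⟨hr, h1⟩), hφ,
        ← ENNReal.ofReal_mul hr.le]
      congr 1
      field_simp
    · rw [if_neg (by nlinarith), Set.indicator_of_notMem (show r ∉ Set.Ioo (0 : ℝ) 1 from
        fun h => h1 h.2), ENNReal.ofReal_zero, mul_zero]
  rw [setLIntegral_congr_fun polarCoord.open_target.measurableSet hpolar]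
  -- (f) the product integral `(∫₀¹ 4√2 (1 - ¾r²) dr) · 2π`
  have hφm : Measurable φ := by
    rw [hφ]
    exact ENNReal.measurable_ofReal.comp (by fun_prop)
  rw [show polarCoord.target = Ioi (0 : ℝ) ×ˢ Ioo (-Real.pi) Real.pi from rfl,
    Measure.volume_eq_prod, ← Measure.prod_restrict,
    lintegral_prod_mul ((hφm.indicator measurableSet_Ioo).aemeasurable) aemeasurable_const,
    lintegral_indicator measurableSet_Ioo, Measure.restrict_restrict measurableSet_Ioo,
    Set.inter_eq_left.2 Set.Ioo_subset_Ioi_self, lintegral_const, Measure.restrict_apply_univ,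
    Real.volume_Ioo, one_mul]
  -- the radial integral
  have hrad : ∫⁻ r in Ioo (0 : ℝ) 1, φ r = ENNReal.ofReal (3 * Real.sqrt 2) := by
    have hcont : Continuous fun r : ℝ => 4 * Real.sqrt 2 * (1 - 3 / 4 * r ^ 2) := by fun_prop
    have hint : IntegrableOn (fun r : ℝ => 4 * Real.sqrt 2 * (1 - 3 / 4 * r ^ 2)) (Ioo 0 1) :=
      (hcont.integrableOn_Icc).mono_set Ioo_subset_Icc_self
    have hnn : 0 ≤ᵐ[volume.restrict (Ioo (0 : ℝ) 1)] fun r : ℝ => 4 * Real.sqrt 2 * (1 - 3 / 4 * r ^ 2) := by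
      refine (ae_restrict_iff' measurableSet_Ioo).2 (Eventually.of_forall fun r hr => ?_)
      have : r ^ 2 < 1 := by nlinarith [hr.1, hr.2]
      show (0 : ℝ) ≤ 4 * Real.sqrt 2 * (1 - 3 / 4 * r ^ 2)
      exact mul_nonneg (by positivity) (by nlinarith)
    rw [hφ, ← ofReal_integral_eq_lintegral_ofReal hint hnn, ← integral_Ioc_eq_integral_Ioo,
      ← intervalIntegral.integral_of_le zero_le_one]
    congr 1
    have : ∀ x : ℝ, 4 * Real.sqrt 2 * (1 - 3 / 4 * x ^ 2) =
        4 * Real.sqrt 2 - (3 * Real.sqrt 2) * x ^ 2 := fun x => by ring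
    simp_rw [this]
    rw [intervalIntegral.integral_sub intervalIntegrable_const
      (Continuous.intervalIntegrable (by fun_prop) _ _), intervalIntegral.integral_const,
      intervalIntegral.integral_const_mul, integral_pow]
    norm_num
    ring
  rw [hrad, ← ENNReal.ofReal_mul (by positivity)]
  refine le_of_eq ?_
  congr 1
  ring

/-- **Discharge of (E)** `klsIntegral_two_le`: `I(2) ≤ 7/10`. In fact
`I(2) ≤ 6√2π/(2π)² = 3√2/(2π) = 0.6752…` (`lintegral_klsIntegrand_two_le`); the source reports
the numerical value `I(2) = 0.65` (Kennedy–Lieb–Shastry 1988, after eq. (8)); the analytic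
majorant loses only the term `s²t²` in `(1-s²)(1-t²) = 1 - s² - t² + s²t²` and the AM–GM slack.
[Kennedy–Lieb–Shastry 1988, after eq. (8)] [cite: KLS1988PRL, after eq. (8)] -/
theorem klsIntegral_two_le_holds : klsIntegral_two_le := by
  unfold klsIntegral_two_le klsIntegral
  rw [integral_eq_lintegral_of_nonneg_ae (Eventually.of_forall (klsIntegrand_nonneg 2))
    (measurable_klsIntegrand 2).aestronglyMeasurable]
  have htr := ENNReal.toReal_le_of_le_ofReal (by positivity) lintegral_klsIntegrand_two_le
  have hπ : (0 : ℝ) < (2 * Real.pi) ^ 2 := by positivity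
  refine (div_le_div_of_nonneg_right htr hπ.le).trans ?_
  rw [div_le_iff₀ hπ]
  have hsqrt2 : Real.sqrt 2 < 1.4143 := by
    rw [Real.sqrt_lt' (by norm_num)]
    norm_num
  nlinarith [Real.pi_gt_d2, Real.pi_pos]

end IntegralE


/-! ### (R) The one-variable KLS function `G(y) = √((1+y)/(1-y)) · y₊`: monotone and convex -/

section KLSFunction

/-- `G(y) = √((1+y)/(1-y)) · y₊` is nondecreasing below `1` (product of the nonnegative
nondecreasing functions `√(-1 + 2/(1-y))` and `y₊`). [Kennedy–Lieb–Shastry 1988, after eq. (8):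
"`F(x) = x[(1+x)/(1-x)]^{1/2}` is an increasing … function"] [folklore] -/
theorem klsG_mono {y₁ y₂ : ℝ} (h : y₁ ≤ y₂) (h₂ : y₂ < 1) :
    Real.sqrt ((1 + y₁) / (1 - y₁)) * max y₁ 0 ≤ Real.sqrt ((1 + y₂) / (1 - y₂)) * max y₂ 0 := by
  have hq : (1 + y₁) / (1 - y₁) ≤ (1 + y₂) / (1 - y₂) := by
    rw [div_le_div_iff₀ (by linarith) (by linarith)]
    nlinarith
  exact mul_le_mul (Real.sqrt_le_sqrt hq) (max_le_max h le_rfl) (le_max_right _ _)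
    (Real.sqrt_nonneg _)

/-- `d/dy (1 - y²) = -2y`. [folklore] -/
theorem hasDerivAt_one_sub_sq (y : ℝ) : HasDerivAt (fun y : ℝ => 1 - y ^ 2) (-(2 * y)) y := by
  simpa using (hasDerivAt_pow 2 y).const_sub 1

/-- `ψ(y) = (1 - y²)^{-1/2}` has derivative `ψ'(y) = y (1 - y²)^{-3/2}`. [folklore] -/
theorem hasDerivAt_klsPsi {y : ℝ} (hy : 1 - y ^ 2 ≠ 0) :
    HasDerivAt (fun y : ℝ => (1 - y ^ 2) ^ (-(1 / 2 : ℝ))) (y * (1 - y ^ 2) ^ (-(3 / 2 : ℝ))) y := by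
  have h2 := (hasDerivAt_one_sub_sq y).rpow_const (p := -(1 / 2 : ℝ)) (Or.inl hy)
  convert h2 using 1
  rw [show (-(1 / 2 : ℝ)) - 1 = -(3 / 2 : ℝ) by norm_num]
  ring

/-- `ψ'` has derivative `ψ''(y) = (1 - y²)^{-3/2} + 3 y² (1 - y²)^{-5/2} ≥ 0`. [folklore] -/
theorem hasDerivAt_klsPsi_deriv {y : ℝ} (hy : 1 - y ^ 2 ≠ 0) :
    HasDerivAt (fun y : ℝ => y * (1 - y ^ 2) ^ (-(3 / 2 : ℝ)))
      ((1 - y ^ 2) ^ (-(3 / 2 : ℝ)) + 3 * y ^ 2 * (1 - y ^ 2) ^ (-(5 / 2 : ℝ))) y := by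
  have h2 : HasDerivAt (fun y : ℝ => y * (1 - y ^ 2) ^ (-(3 / 2 : ℝ)))
      (1 * (1 - y ^ 2) ^ (-(3 / 2 : ℝ)) +
        y * (-(2 * y) * (-(3 / 2 : ℝ)) * (1 - y ^ 2) ^ (-(3 / 2 : ℝ) - 1))) y :=
    (hasDerivAt_id' y).mul ((hasDerivAt_one_sub_sq y).rpow_const (p := -(3 / 2 : ℝ)) (Or.inl hy))
  refine h2.congr_deriv ?_
  rw [show (-(3 / 2 : ℝ)) - 1 = -(5 / 2 : ℝ) by norm_num]
  ring

/-- `ψ(y) = (1 - y²)^{-1/2}` is convex on `[0, 1)` (its second derivative is a sum of nonnegative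
terms). [folklore] -/
theorem convexOn_klsPsi :
    ConvexOn ℝ (Ico (0 : ℝ) 1) (fun y : ℝ => (1 - y ^ 2) ^ (-(1 / 2 : ℝ))) := by
  have hint : interior (Ico (0 : ℝ) 1) = Ioo 0 1 := interior_Ico
  have hne : ∀ y ∈ Ioo (0 : ℝ) 1, 1 - y ^ 2 ≠ 0 := fun y hy => by nlinarith [hy.1, hy.2]
  refine convexOn_of_hasDerivWithinAt2_nonneg (convex_Ico 0 1)
    (f' := fun y => y * (1 - y ^ 2) ^ (-(3 / 2 : ℝ)))
    (f'' := fun y => (1 - y ^ 2) ^ (-(3 / 2 : ℝ)) + 3 * y ^ 2 * (1 - y ^ 2) ^ (-(5 / 2 : ℝ)))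
    ?_ ?_ ?_ ?_
  · intro y hy
    exact (hasDerivAt_klsPsi (by nlinarith [hy.1, hy.2])).continuousAt.continuousWithinAt
  · intro y hy
    rw [hint] at hy ⊢
    exact (hasDerivAt_klsPsi (hne y hy)).hasDerivWithinAt
  · intro y hy
    rw [hint] at hy ⊢
    exact (hasDerivAt_klsPsi_deriv (hne y hy)).hasDerivWithinAt
  · intro y hy
    rw [hint] at hy
    have hb : 0 ≤ 1 - y ^ 2 := by nlinarith [hy.1, hy.2]
    exact add_nonneg (Real.rpow_nonneg hb _) (mul_nonneg (by positivity) (Real.rpow_nonneg hb _))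

/-- `ψ ≥ 0` on `[0, 1)`. [folklore] -/
theorem klsPsi_nonneg {y : ℝ} (hy : y ∈ Ico (0 : ℝ) 1) : 0 ≤ (1 - y ^ 2) ^ (-(1 / 2 : ℝ)) :=
  Real.rpow_nonneg (by nlinarith [hy.1, hy.2]) _

/-- `ψ` is nondecreasing on `[0, 1)`. [folklore] -/
theorem monotoneOn_klsPsi :
    MonotoneOn (fun y : ℝ => (1 - y ^ 2) ^ (-(1 / 2 : ℝ))) (Ico (0 : ℝ) 1) := by
  intro y₁ h₁ y₂ h₂ h
  have hb₂ : 0 < 1 - y₂ ^ 2 := by nlinarith [h₂.1, h₂.2]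
  have hle : 1 - y₂ ^ 2 ≤ 1 - y₁ ^ 2 := by nlinarith [h₁.1]
  exact (Real.rpow_le_rpow_iff_of_neg (hb₂.trans_le hle) hb₂ (by norm_num)).2 hle

/-- `φ(y) = (y + y²) (1 - y²)^{-1/2}` (`= y[(1+y)/(1-y)]^{1/2}` on `[0,1)`) is convex on `[0, 1)`:
the product of two nonnegative, nondecreasing, convex functions. [Kennedy–Lieb–Shastry 1988, after
eq. (8): "`F(x) = x[(1+x)/(1-x)]^{1/2}` is an increasing convex function of `x`"] [folklore] -/
theorem convexOn_klsPhi :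
    ConvexOn ℝ (Ico (0 : ℝ) 1) (fun y : ℝ => (y + y ^ 2) * (1 - y ^ 2) ^ (-(1 / 2 : ℝ))) := by
  have hq : ConvexOn ℝ (Ico (0 : ℝ) 1) (fun y : ℝ => y + y ^ 2) :=
    (convexOn_id (convex_Ico 0 1)).add
      ((convexOn_pow 2).subset Ico_subset_Ici_self (convex_Ico 0 1))
  have hqm : MonotoneOn (fun y : ℝ => y + y ^ 2) (Ico (0 : ℝ) 1) := by
    intro y₁ h₁ y₂ h₂ h
    have := h₁.1
    nlinarith
  exact hq.mul convexOn_klsPsi (fun y hy => by have := hy.1; positivity)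
    (fun y hy => klsPsi_nonneg hy) (hqm.monovaryOn monotoneOn_klsPsi)

/-- `φ` is nondecreasing on `[0, 1)`. [folklore] -/
theorem monotoneOn_klsPhi :
    MonotoneOn (fun y : ℝ => (y + y ^ 2) * (1 - y ^ 2) ^ (-(1 / 2 : ℝ))) (Ico (0 : ℝ) 1) := by
  intro y₁ h₁ y₂ h₂ h
  have := h₁.1
  have := h₂.1
  exact mul_le_mul (by nlinarith) (monotoneOn_klsPsi h₁ h₂ h) (klsPsi_nonneg h₁) (by positivity)

/-- `G = φ ∘ (·)₊` below `1`: `√((1+y)/(1-y)) · y₊ = (y₊ + y₊²)(1 - y₊²)^{-1/2}`. [folklore] -/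
theorem klsG_eq_klsPhi_pos {y : ℝ} (hy : y < 1) :
    Real.sqrt ((1 + y) / (1 - y)) * max y 0 =
      (max y 0 + max y 0 ^ 2) * (1 - max y 0 ^ 2) ^ (-(1 / 2 : ℝ)) := by
  rcases le_or_gt y 0 with h | h
  · simp [max_eq_right h]
  · rw [max_eq_left h.le]
    have h1 : (0 : ℝ) < 1 - y := by linarith
    have h2 : (0 : ℝ) < 1 + y := by linarith
    have h3 : (0 : ℝ) < 1 - y ^ 2 := by nlinarith
    have h1' : (1 : ℝ) - y ≠ 0 := h1.ne'
    have h3' : (1 : ℝ) - y ^ 2 ≠ 0 := h3.ne'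
    have h4 : (1 + y) / (1 - y) = (1 + y) ^ 2 / (1 - y ^ 2) := by
      field_simp
      ring
    rw [h4, Real.sqrt_div (sq_nonneg _), Real.sqrt_sq h2.le, Real.rpow_neg h3.le,
      ← Real.sqrt_eq_rpow]
    have h5 : 0 < Real.sqrt (1 - y ^ 2) := Real.sqrt_pos.2 h3
    field_simp

/-- **`G` is convex on `[-1, 1)`.** [Kennedy–Lieb–Shastry 1988, after eq. (8)] [folklore] -/
theorem convexOn_klsG :
    ConvexOn ℝ (Ico (-1 : ℝ) 1) (fun y : ℝ => Real.sqrt ((1 + y) / (1 - y)) * max y 0) := by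
  have himg : (fun y : ℝ => max y 0) '' Ico (-1 : ℝ) 1 = Ico 0 1 := by
    ext z
    simp only [mem_image, mem_Ico]
    constructor
    · rintro ⟨y, ⟨-, hy2⟩, rfl⟩
      exact ⟨le_max_right _ _, max_lt hy2 one_pos⟩
    · rintro ⟨hz1, hz2⟩
      exact ⟨z, ⟨by linarith, hz2⟩, max_eq_left hz1⟩
  have hpos : ConvexOn ℝ (Ico (-1 : ℝ) 1) (fun y : ℝ => max y 0) :=
    (convexOn_id (convex_Ico _ _)).sup (convexOn_const 0 (convex_Ico _ _))
  have hg : ConvexOn ℝ ((fun y : ℝ => max y 0) '' Ico (-1 : ℝ) 1)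
      (fun y : ℝ => (y + y ^ 2) * (1 - y ^ 2) ^ (-(1 / 2 : ℝ))) := by
    rw [himg]; exact convexOn_klsPhi
  have hg' : MonotoneOn (fun y : ℝ => (y + y ^ 2) * (1 - y ^ 2) ^ (-(1 / 2 : ℝ)))
      ((fun y : ℝ => max y 0) '' Ico (-1 : ℝ) 1) := by
    rw [himg]; exact monotoneOn_klsPhi
  refine (hg.comp hpos hg').congr fun y hy => ?_
  simp only [Function.comp]
  exact (klsG_eq_klsPhi_pos hy.2).symm

end KLSFunction

/-! ### (R) Discrete Jensen over pairs of directions, and combinatorics of the dual torus -/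

section Jensen

open Finset in
/-- `Σ_{i ≠ j} ½(cᵢ + cⱼ) = (d - 1) Σᵢ cᵢ`. [folklore] -/
theorem sum_offDiag_half_add {d : ℕ} (c : Fin d → ℝ) :
    ∑ ij ∈ (univ : Finset (Fin d)).offDiag, (c ij.1 + c ij.2) / 2 = ((d : ℝ) - 1) * ∑ i, c i := by
  have h := sum_union (disjoint_diag_offDiag (univ : Finset (Fin d)))
    (f := fun ij : Fin d × Fin d => (c ij.1 + c ij.2) / 2)
  rw [diag_union_offDiag, sum_product, sum_diag] at h
  have h2 : ∑ i : Fin d, ∑ j : Fin d, (c i + c j) / 2 = d * ∑ i, c i := by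
    have h2a : ∀ i : Fin d, ∑ j : Fin d, (c i + c j) / 2 = d * (c i / 2) + (∑ j, c j) / 2 := by
      intro i
      rw [sum_congr rfl fun j _ => add_div (c i) (c j) 2, sum_add_distrib, sum_const, card_univ,
        Fintype.card_fin, nsmul_eq_mul, ← sum_div]
    rw [sum_congr rfl fun i _ => h2a i, sum_add_distrib, sum_const, card_univ, Fintype.card_fin,
      nsmul_eq_mul, ← mul_sum, ← sum_div]
    ring
  have h3 : ∑ i : Fin d, (c i + c i) / 2 = ∑ i, c i := sum_congr rfl fun i _ => by ring
  rw [h2, h3] at h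
  linarith

open Finset in
/-- **Discrete Jensen for the KLS function** (Kennedy–Lieb–Shastry's convexity argument, in
finite volume): for `c ∈ [-1,1)^d`, `d ≥ 2`, since `d⁻¹ Σᵢ cᵢ` is the average over the ordered
pairs `i ≠ j` of `½(cᵢ + cⱼ)` and `G` is convex on `[-1, 1)`,
`G(d⁻¹ Σᵢ cᵢ) ≤ (d(d-1))⁻¹ Σ_{i ≠ j} G(½(cᵢ + cⱼ))`.
[Kennedy–Lieb–Shastry 1988, after eq. (8)] [cite: KLS1988PRL, after eq. (8)] -/
theorem klsG_avg_le {d : ℕ} (hd : 2 ≤ d) (c : Fin d → ℝ) (hc : ∀ i, c i ∈ Set.Ico (-1 : ℝ) 1) :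
    Real.sqrt ((1 + (∑ i, c i) / d) / (1 - (∑ i, c i) / d)) * max ((∑ i, c i) / d) 0 ≤
      (∑ ij ∈ (univ : Finset (Fin d)).offDiag,
        Real.sqrt ((1 + (c ij.1 + c ij.2) / 2) / (1 - (c ij.1 + c ij.2) / 2)) *
          max ((c ij.1 + c ij.2) / 2) 0) / ((d : ℝ) * (d - 1)) := by
  have hd2 : (2 : ℝ) ≤ d := by exact_mod_cast hd
  have hd0 : (0 : ℝ) < d := by linarith
  have hd1 : (0 : ℝ) < (d : ℝ) - 1 := by linarith
  have hcard : (((univ : Finset (Fin d)).offDiag).card : ℝ) = d * (d - 1) := by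
    rw [offDiag_card, card_univ, Fintype.card_fin, Nat.cast_sub (Nat.le_mul_self d),
      Nat.cast_mul]
    ring
  have h₁ : ∑ ij ∈ (univ : Finset (Fin d)).offDiag, (fun _ : Fin d × Fin d => 1 / ((d : ℝ) * (d - 1))) ij
      = 1 := by
    rw [sum_const, nsmul_eq_mul, hcard]
    field_simp
  have hmem : ∀ ij ∈ (univ : Finset (Fin d)).offDiag,
      (fun ij : Fin d × Fin d => (c ij.1 + c ij.2) / 2) ij ∈ Set.Ico (-1 : ℝ) 1 := by
    rintro ⟨i, j⟩ -
    exact ⟨by linarith [(hc i).1, (hc j).1], by linarith [(hc i).2, (hc j).2]⟩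
  have hJ := convexOn_klsG.map_sum_le (fun _ _ => by positivity) h₁ hmem
  have hbary : ∑ ij ∈ (univ : Finset (Fin d)).offDiag,
      (fun _ : Fin d × Fin d => 1 / ((d : ℝ) * (d - 1))) ij •
        (fun ij : Fin d × Fin d => (c ij.1 + c ij.2) / 2) ij = (∑ i, c i) / d := by
    simp only [smul_eq_mul]
    rw [← mul_sum, sum_offDiag_half_add]
    field_simp
  rw [hbary] at hJ
  refine hJ.trans (le_of_eq ?_)
  rw [sum_div]
  refine sum_congr rfl fun ij _ => ?_
  simp only [smul_eq_mul]
  ring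

/-- **Sums over the torus of a function of two coordinates**: for `i ≠ j` in `Fin (d+2)`,
`Σ_{k : Fin (d+2) → X} f(kᵢ, kⱼ) = |X|^d Σ_{a,b} f(a,b)`. [folklore] -/
theorem sum_pi_apply_two {X M : Type*} [Fintype X] [AddCommMonoid M] {d : ℕ} {i j : Fin (d + 2)}
    (hij : i ≠ j) (f : X → X → M) :
    ∑ k : Fin (d + 2) → X, f (k i) (k j) = Fintype.card X ^ d • ∑ a, ∑ b, f a b := by
  classical
  obtain ⟨z, rfl⟩ := Fin.exists_succAbove_eq hij.symm
  have h1 : ∑ k : Fin (d + 2) → X, f (k i) (k (i.succAbove z)) =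
      ∑ a : X, ∑ g : Fin (d + 1) → X, f a (g z) := by
    rw [← Fintype.sum_prod_type', ← (Fin.insertNthEquiv (fun _ => X) i).sum_comp]
    simp
  have h2 : ∀ a : X, ∑ g : Fin (d + 1) → X, f a (g z) = Fintype.card X ^ d • ∑ b, f a b := by
    intro a
    rw [← (Fin.insertNthEquiv (fun _ => X) z).sum_comp, Fintype.sum_prod_type]
    simp [Finset.sum_const, Finset.card_univ, Finset.smul_sum]
  rw [h1, Finset.smul_sum]
  exact Finset.sum_congr rfl fun a _ => h2 a

end Jensen

/-! ### (R) The KLS integrand on the dual torus -/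

section Integrand

variable {d : ℕ}

/-- The KLS integrand is `G` of the average cosine: `F_ν(p) = G(ν⁻¹ Σᵢ cos pᵢ)`,
`G(y) = √((1+y)/(1-y)) y₊`. [Kennedy–Lieb–Shastry 1988, eq. (8)] [folklore] -/
theorem klsIntegrand_eq_G {ν : ℕ} (hν : ν ≠ 0) (p : Fin ν → ℝ) :
    klsIntegrand ν p =
      Real.sqrt ((1 + (∑ i, Real.cos (p i)) / ν) / (1 - (∑ i, Real.cos (p i)) / ν)) *
        max ((∑ i, Real.cos (p i)) / ν) 0 := by
  have hν' : (ν : ℝ) ≠ 0 := by exact_mod_cast hν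
  rw [klsIntegrand]
  congr 2
  rw [Finset.sum_add_distrib, Finset.sum_sub_distrib, Finset.sum_const, Finset.card_univ,
    Fintype.card_fin, nsmul_eq_mul, mul_one]
  rw [show (1 : ℝ) + (∑ i, Real.cos (p i)) / ν = (ν + ∑ i, Real.cos (p i)) / ν by field_simp,
    show (1 : ℝ) - (∑ i, Real.cos (p i)) / ν = (ν - ∑ i, Real.cos (p i)) / ν by field_simp,
    div_div_div_cancel_right₀ hν']

/-- The KLS integrand depends on the momenta only through their cosines. [folklore] -/
theorem klsIntegrand_congr_cos {ν : ℕ} {p q : Fin ν → ℝ} (h : ∀ i, Real.cos (p i) = Real.cos (q i)) :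
    klsIntegrand ν p = klsIntegrand ν q := by
  simp only [klsIntegrand, h]

/-- The two-dimensional KLS integrand at a dual-torus point, as `G(½(cos p₀ + cos p₁))`.
[Kennedy–Lieb–Shastry 1988, eq. (8)] [folklore] -/
theorem klsIntegrand_two' (p : Fin 2 → ℝ) :
    klsIntegrand 2 p =
      Real.sqrt ((1 + (Real.cos (p 0) + Real.cos (p 1)) / 2) /
          (1 - (Real.cos (p 0) + Real.cos (p 1)) / 2)) *
        max ((Real.cos (p 0) + Real.cos (p 1)) / 2) 0 := by
  rw [klsIntegrand_eq_G two_ne_zero, Fin.sum_univ_two]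
  norm_num

/-- A nonzero coordinate of a dual-torus point has `cos pᵢ < 1` (`pᵢ ∈ (0, 2π)`).
[folklore] -/
theorem cos_latticeMomentum_lt_one {L : ℕ} [NeZero L] {k : TorusSite d L} {i : Fin d}
    (hi : k i ≠ 0) : Real.cos (latticeMomentum L k i) < 1 := by
  have hL : (0 : ℝ) < L := by exact_mod_cast Nat.pos_of_ne_zero (NeZero.ne L)
  refine lt_of_le_of_ne (Real.cos_le_one _) fun h => hi ?_
  have h0 : 0 ≤ latticeMomentum L k i := by rw [latticeMomentum_apply]; positivity
  have hval : ((k i).val : ℝ) < L := by exact_mod_cast ZMod.val_lt (k i)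
  have h2 : latticeMomentum L k i < 2 * Real.pi := by
    rw [latticeMomentum_apply, div_lt_iff₀ hL]
    nlinarith [Real.pi_pos]
  have h1 := (Real.cos_eq_one_iff_of_lt_of_lt (by linarith [Real.pi_pos]) h2).1 h
  rw [latticeMomentum_apply, div_eq_zero_iff] at h1
  rcases h1 with h1 | h1
  · have : ((k i).val : ℝ) = 0 := by
      rcases mul_eq_zero.1 h1 with h3 | h3
      · exact absurd h3 (by positivity)
      · exact h3
    exact (ZMod.val_eq_zero (k i)).1 (by exact_mod_cast this)
  · exact absurd h1 hL.ne'

/-- The cosine of a dual-torus momentum in terms of the signed representative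
`kᵢ ∈ (-L/2, L/2]` (`ZMod.valMinAbs`): `cos(2π kᵢ.val/L) = cos((2π/L) · valMinAbs kᵢ)`.
[folklore] -/
theorem cos_latticeMomentum_eq_cos_valMinAbs (L : ℕ) [NeZero L] (k : TorusSite d L) (i : Fin d) :
    Real.cos (latticeMomentum L k i) = Real.cos (2 * Real.pi / L * ((k i).valMinAbs : ℝ)) := by
  have hL : (L : ℝ) ≠ 0 := by exact_mod_cast NeZero.ne L
  rw [latticeMomentum_apply]
  have hv := ZMod.val_eq_ite_valMinAbs (k i)
  split_ifs at hv with hc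
  · have hv2 : ((k i).val : ℤ) = (k i).valMinAbs := by simpa using hv
    have hv' : ((k i).val : ℝ) = ((k i).valMinAbs : ℝ) := by exact_mod_cast hv2
    rw [hv']
    ring_nf
  · have hv' : ((k i).val : ℝ) = ((k i).valMinAbs : ℝ) + L := by exact_mod_cast hv
    rw [hv', show 2 * Real.pi * (((k i).valMinAbs : ℝ) + L) / L =
      2 * Real.pi / L * ((k i).valMinAbs : ℝ) + 2 * Real.pi by field_simp, Real.cos_add_two_pi]

/-- The signed representative satisfies `-L < 2 · valMinAbs a ≤ L`. [folklore] -/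
theorem valMinAbs_bounds (L : ℕ) [NeZero L] (a : ZMod L) :
    -(L : ℝ) < 2 * (a.valMinAbs : ℝ) ∧ 2 * (a.valMinAbs : ℝ) ≤ L := by
  have h := ZMod.valMinAbs_mem_Ioc a
  constructor
  · have h1 : (-(L : ℤ) : ℝ) < ((a.valMinAbs * 2 : ℤ) : ℝ) := by exact_mod_cast h.1
    push_cast at h1
    linarith
  · have h2 : ((a.valMinAbs * 2 : ℤ) : ℝ) ≤ ((L : ℤ) : ℝ) := by exact_mod_cast h.2
    push_cast at h2
    linarith

end Integrand



/-! ### (R) Monotone cells: the punctured two-dimensional Riemann sum is below the integral -/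

section Cells

open Finset

variable {d : ℕ}

/-- The KLS integrand `F_ν(p) = G(ν⁻¹ Σᵢ cos pᵢ)` is monotone in the cosines, below `cos = 1`.
[folklore] -/
theorem klsIntegrand_mono_cos {ν : ℕ} (hν : ν ≠ 0) {p q : Fin ν → ℝ}
    (h : ∀ i, Real.cos (p i) ≤ Real.cos (q i)) (hq : ∀ i, Real.cos (q i) < 1) :
    klsIntegrand ν p ≤ klsIntegrand ν q := by
  rw [klsIntegrand_eq_G hν, klsIntegrand_eq_G hν]
  have hν' : (0 : ℝ) < ν := by exact_mod_cast Nat.pos_of_ne_zero hν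
  haveI : NeZero ν := ⟨hν⟩
  refine klsG_mono (div_le_div_of_nonneg_right (sum_le_sum fun i _ => h i) hν'.le) ?_
  rw [div_lt_one hν']
  have : ∑ i : Fin ν, Real.cos (q i) < ∑ _i : Fin ν, (1 : ℝ) :=
    sum_lt_sum_of_nonempty univ_nonempty fun i _ => hq i
  simpa using this

/-- The cosine of a dual-torus momentum in terms of the signed representative
`valMinAbs a ∈ (-L/2, L/2]`: `cos(2π a.val / L) = cos((2π/L) · valMinAbs a)`. [folklore] -/
theorem cos_two_pi_val_div (L : ℕ) [NeZero L] (a : ZMod L) :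
    Real.cos (2 * Real.pi * (a.val : ℝ) / L) = Real.cos (2 * Real.pi / L * (a.valMinAbs : ℝ)) := by
  have hL : (L : ℝ) ≠ 0 := by exact_mod_cast NeZero.ne L
  have hv := ZMod.val_eq_ite_valMinAbs a
  split_ifs at hv with hc
  · have hv2 : (a.val : ℤ) = a.valMinAbs := by simpa using hv
    have hv' : (a.val : ℝ) = (a.valMinAbs : ℝ) := by exact_mod_cast hv2
    rw [hv']
    ring_nf
  · have hv' : (a.val : ℝ) = (a.valMinAbs : ℝ) + L := by exact_mod_cast hv
    rw [hv', show 2 * Real.pi * ((a.valMinAbs : ℝ) + L) / L =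
      2 * Real.pi / L * (a.valMinAbs : ℝ) + 2 * Real.pi by field_simp, Real.cos_add_two_pi]

/-- **The cell toward the origin.** For a nonzero residue `a` with signed representative
`m ∈ (-L/2, L/2]`, put `j = m - 1` if `m > 0` and `j = m` if `m < 0`; on the cell
`θ ∈ (2πj/L, 2π(j+1)/L)` one has `|θ| ≤ 2π|m|/L ≤ π`, hence `cos(2πm/L) ≤ cos θ < 1` and
`θ ∈ [-π, π]`. [Kennedy–Lieb–Shastry 1988, "passing from sums to integrals"; the standard
monotone comparison of a Riemann sum with the integral] [folklore] -/
theorem kls_cell_spec {L : ℕ} [NeZero L] {a : ZMod L} (ha : a ≠ 0) {θ : ℝ}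
    (hθ : θ ∈ Set.Ioo
      (2 * Real.pi / L * ((if 0 < a.valMinAbs then a.valMinAbs - 1 else a.valMinAbs : ℤ) : ℝ))
      (2 * Real.pi / L *
        (((if 0 < a.valMinAbs then a.valMinAbs - 1 else a.valMinAbs : ℤ) : ℝ) + 1))) :
    Real.cos (2 * Real.pi * (a.val : ℝ) / L) ≤ Real.cos θ ∧ Real.cos θ < 1 ∧
      θ ∈ Set.Icc (-Real.pi) Real.pi := by
  have hL : (0 : ℝ) < L := by exact_mod_cast Nat.pos_of_ne_zero (NeZero.ne L)
  have hh : 0 < 2 * Real.pi / L := by positivity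
  have hm0 : a.valMinAbs ≠ 0 := fun h => ha ((ZMod.valMinAbs_eq_zero a).1 h)
  obtain ⟨hlo, hhi⟩ := valMinAbs_bounds L a
  rw [cos_two_pi_val_div]
  have hπL : 2 * Real.pi / L * ((L : ℝ) / 2) = Real.pi := by field_simp
  have hcos1 : ∀ {t : ℝ}, -Real.pi < t → t ≤ Real.pi → t ≠ 0 → Real.cos t < 1 := by
    intro t h1 h2 h3
    refine lt_of_le_of_ne (Real.cos_le_one t) fun h => h3 ?_
    exact (Real.cos_eq_one_iff_of_lt_of_lt (by linarith [Real.pi_pos])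
      (by linarith [Real.pi_pos])).1 h
  split_ifs at hθ with hpos
  · -- `m ≥ 1`: the cell `(h(m-1), hm) ⊂ [0, π]`
    push_cast at hθ
    have h1 : (1 : ℝ) ≤ a.valMinAbs := by exact_mod_cast hpos
    have hθpos : 0 < θ := lt_of_le_of_lt (mul_nonneg hh.le (by linarith)) hθ.1
    have hθm : θ ≤ 2 * Real.pi / L * (a.valMinAbs : ℝ) := by nlinarith [hθ.2]
    have hmπ : 2 * Real.pi / L * (a.valMinAbs : ℝ) ≤ Real.pi := by
      have h2 := mul_le_mul_of_nonneg_left (show (a.valMinAbs : ℝ) ≤ (L : ℝ) / 2 by linarith) hh.le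
      rwa [hπL] at h2
    exact ⟨Real.cos_le_cos_of_nonneg_of_le_pi hθpos.le hmπ hθm,
      hcos1 (by linarith [Real.pi_pos]) (hθm.trans hmπ) hθpos.ne',
      ⟨by linarith [Real.pi_pos], hθm.trans hmπ⟩⟩
  · -- `m ≤ -1`: the cell `(hm, h(m+1)) ⊂ (-π, 0]`
    have h1 : (a.valMinAbs : ℝ) ≤ -1 := by
      have : a.valMinAbs ≤ -1 := by omega
      exact_mod_cast this
    have hθneg : θ < 0 :=
      lt_of_lt_of_le hθ.2 (mul_nonpos_of_nonneg_of_nonpos hh.le (by linarith))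
    have hθm : 2 * Real.pi / L * (a.valMinAbs : ℝ) ≤ θ := hθ.1.le
    have hmπ : -Real.pi < 2 * Real.pi / L * (a.valMinAbs : ℝ) := by
      have h3 : 2 * Real.pi / L * (-(L : ℝ) / 2) = -Real.pi := by field_simp
      have h2 := mul_lt_mul_of_pos_left (show (-(L : ℝ) / 2) < (a.valMinAbs : ℝ) by linarith) hh
      rwa [h3] at h2
    refine ⟨?_, hcos1 (by linarith) (by linarith [Real.pi_pos]) hθneg.ne,
      ⟨by linarith, by linarith [Real.pi_pos]⟩⟩
    rw [← Real.cos_neg (2 * Real.pi / L * (a.valMinAbs : ℝ)), ← Real.cos_neg θ]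
    exact Real.cos_le_cos_of_nonneg_of_le_pi (by linarith) (by linarith) (by linarith)

/-- Distinct nonzero residues have disjoint cells. [folklore] -/
theorem kls_cell_disjoint {L : ℕ} [NeZero L] {a b : ZMod L} (ha : a ≠ 0) (hb : b ≠ 0)
    (hab : a ≠ b) :
    Disjoint
      (Set.Ioo
        (2 * Real.pi / L * ((if 0 < a.valMinAbs then a.valMinAbs - 1 else a.valMinAbs : ℤ) : ℝ))
        (2 * Real.pi / L *
          (((if 0 < a.valMinAbs then a.valMinAbs - 1 else a.valMinAbs : ℤ) : ℝ) + 1)))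
      (Set.Ioo
        (2 * Real.pi / L * ((if 0 < b.valMinAbs then b.valMinAbs - 1 else b.valMinAbs : ℤ) : ℝ))
        (2 * Real.pi / L *
          (((if 0 < b.valMinAbs then b.valMinAbs - 1 else b.valMinAbs : ℤ) : ℝ) + 1))) := by
  have hL : (0 : ℝ) < L := by exact_mod_cast Nat.pos_of_ne_zero (NeZero.ne L)
  have hh : 0 < 2 * Real.pi / L := by positivity
  have hma : a.valMinAbs ≠ 0 := fun h => ha ((ZMod.valMinAbs_eq_zero a).1 h)
  have hmb : b.valMinAbs ≠ 0 := fun h => hb ((ZMod.valMinAbs_eq_zero b).1 h)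
  have hmab : a.valMinAbs ≠ b.valMinAbs := fun h => hab (ZMod.valMinAbs_inj.1 h)
  set ja : ℤ := if 0 < a.valMinAbs then a.valMinAbs - 1 else a.valMinAbs with hja
  set jb : ℤ := if 0 < b.valMinAbs then b.valMinAbs - 1 else b.valMinAbs with hjb
  have hj : ja ≠ jb := by
    intro h
    rw [hja, hjb] at h
    split_ifs at h <;> omega
  rw [Set.disjoint_left]
  intro θ h₁ h₂
  rcases lt_or_gt_of_ne hj with hlt | hlt
  · have : (ja : ℝ) + 1 ≤ jb := by exact_mod_cast hlt
    nlinarith [h₁.2, h₂.1]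
  · have : (jb : ℝ) + 1 ≤ ja := by exact_mod_cast hlt
    nlinarith [h₁.1, h₂.2]

/-- **The two-dimensional cell bound.** For every side `L ≥ 1`,
`Σ_{a, b ∈ ℤ_L ∖ 0} F₂(2πa/L, 2πb/L) ≤ (L/2π)² ∫_{[-π,π]²} F₂ ≤ (L/2π)² · 6√2π = (3√2/2π) L²`:
each term times the cell area `(2π/L)²` is at most the integral of `F₂` over the cell toward the
origin (on which both cosines are larger, and `F₂` is monotone in the cosines), the cells are
disjoint and lie in `[-π,π]²`, and `∫_{[-π,π]²} F₂ ≤ 6√2π` (`lintegral_klsIntegrand_two_le`).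
[Kennedy–Lieb–Shastry 1988, before eq. (2) and the value of `I(2)` after eq. (8)] [folklore] -/
theorem kls_twoDim_sum_le (L : ℕ) [NeZero L] :
    ∑ v ∈ (univ : Finset (TorusSite 2 L)).filter (fun v => ∀ i, v i ≠ 0),
        klsIntegrand 2 (latticeMomentum L v) ≤
      3 * Real.sqrt 2 / (2 * Real.pi) * (L : ℝ) ^ 2 := by
  have hL : (0 : ℝ) < L := by exact_mod_cast Nat.pos_of_ne_zero (NeZero.ne L)
  set h : ℝ := 2 * Real.pi / L with hh_def
  have hh : 0 < h := by positivity
  set S : Finset (TorusSite 2 L) := (univ : Finset (TorusSite 2 L)).filter (fun v => ∀ i, v i ≠ 0)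
    with hS_def
  set cell : TorusSite 2 L → Set (Fin 2 → ℝ) := fun v => Set.pi univ fun i =>
    Set.Ioo (h * ((if 0 < (v i).valMinAbs then (v i).valMinAbs - 1 else (v i).valMinAbs : ℤ) : ℝ))
      (h * (((if 0 < (v i).valMinAbs then (v i).valMinAbs - 1 else (v i).valMinAbs : ℤ) : ℝ) + 1))
    with hcell_def
  have hmemS : ∀ {v}, v ∈ S → ∀ i, v i ≠ 0 := fun hv => (mem_filter.1 hv).2
  have hmeas : ∀ v, MeasurableSet (cell v) := fun v =>
    MeasurableSet.univ_pi fun i => measurableSet_Ioo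
  have hvol : ∀ v, volume (cell v) = ENNReal.ofReal (h ^ 2) := by
    intro v
    have h1 : ∀ i : Fin 2, volume (Set.Ioo
        (h * ((if 0 < (v i).valMinAbs then (v i).valMinAbs - 1 else (v i).valMinAbs : ℤ) : ℝ))
        (h * (((if 0 < (v i).valMinAbs then (v i).valMinAbs - 1 else (v i).valMinAbs : ℤ) : ℝ)
          + 1))) = ENNReal.ofReal h := by
      intro i
      rw [Real.volume_Ioo]
      congr 1
      ring
    simp only [hcell_def]
    rw [volume_pi_pi, Fin.prod_univ_two, h1, h1, ← ENNReal.ofReal_mul hh.le, sq]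
  have hdisj : Set.PairwiseDisjoint (↑S : Set (TorusSite 2 L)) cell := by
    intro v hv w hw hvw
    obtain ⟨i, hi⟩ : ∃ i, v i ≠ w i := Function.ne_iff.1 hvw
    simp only [Function.onFun, hcell_def]
    exact Set.disjoint_univ_pi.2 ⟨i, kls_cell_disjoint (hmemS hv i) (hmemS hw i) hi⟩
  have hsub : (⋃ v ∈ S, cell v) ⊆ Set.pi univ fun _ : Fin 2 => Set.Icc (-Real.pi) Real.pi := by
    refine Set.iUnion₂_subset fun v hv => Set.pi_mono fun i _ θ hθ => ?_
    exact (kls_cell_spec (hmemS (Finset.mem_coe.1 hv) i) hθ).2.2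
  have hpt : ∀ v ∈ S, ∀ θ ∈ cell v, klsIntegrand 2 (latticeMomentum L v) ≤ klsIntegrand 2 θ := by
    intro v hv θ hθ
    have hθ' := Set.mem_univ_pi.1 hθ
    refine klsIntegrand_mono_cos two_ne_zero (fun i => ?_)
      (fun i => (kls_cell_spec (hmemS hv i) (hθ' i)).2.1)
    rw [latticeMomentum_apply]
    exact (kls_cell_spec (hmemS hv i) (hθ' i)).1
  have hFm : Measurable fun θ : Fin 2 → ℝ => ENNReal.ofReal (klsIntegrand 2 θ) :=
    ENNReal.measurable_ofReal.comp (measurable_klsIntegrand 2)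
  -- the comparison, in `ℝ≥0∞`
  have key : ∑ v ∈ S, ENNReal.ofReal (klsIntegrand 2 (latticeMomentum L v) * h ^ 2) ≤
      ENNReal.ofReal (6 * Real.sqrt 2 * Real.pi) := by
    calc ∑ v ∈ S, ENNReal.ofReal (klsIntegrand 2 (latticeMomentum L v) * h ^ 2)
        = ∑ v ∈ S, ∫⁻ _θ in cell v, ENNReal.ofReal (klsIntegrand 2 (latticeMomentum L v)) := by
          refine sum_congr rfl fun v _ => ?_
          rw [setLIntegral_const, hvol, ENNReal.ofReal_mul (klsIntegrand_nonneg _ _)]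
      _ ≤ ∑ v ∈ S, ∫⁻ θ in cell v, ENNReal.ofReal (klsIntegrand 2 θ) :=
          sum_le_sum fun v hv => setLIntegral_mono hFm fun θ hθ =>
            ENNReal.ofReal_le_ofReal (hpt v hv θ hθ)
      _ = ∫⁻ θ in ⋃ v ∈ S, cell v, ENNReal.ofReal (klsIntegrand 2 θ) :=
          (lintegral_biUnion_finset hdisj (fun v _ => hmeas v) _).symm
      _ ≤ ∫⁻ θ in Set.pi univ (fun _ : Fin 2 => Set.Icc (-Real.pi) Real.pi),
            ENNReal.ofReal (klsIntegrand 2 θ) := lintegral_mono_set hsub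
      _ ≤ ENNReal.ofReal (6 * Real.sqrt 2 * Real.pi) := lintegral_klsIntegrand_two_le
  rw [← ENNReal.ofReal_sum_of_nonneg
      (fun v _ => mul_nonneg (klsIntegrand_nonneg _ _) (sq_nonneg _)),
    ENNReal.ofReal_le_ofReal_iff (by positivity), ← sum_mul] at key
  have hh2 : h ^ 2 = 4 * Real.pi ^ 2 / (L : ℝ) ^ 2 := by
    rw [hh_def]; field_simp; ring
  calc ∑ v ∈ S, klsIntegrand 2 (latticeMomentum L v)
      ≤ 6 * Real.sqrt 2 * Real.pi / h ^ 2 := by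
        rw [le_div_iff₀ (by positivity)]; exact key
    _ = 3 * Real.sqrt 2 / (2 * Real.pi) * (L : ℝ) ^ 2 := by
        rw [hh2]
        field_simp
        ring

end Cells

/-! ### (R) The punctured Riemann sums in dimension `d ≥ 2`: interior by Jensen, boundary by counting -/

section RiemannSum

open Finset

/-- **Jensen, per interior point of the dual torus**: if all coordinates of `k` are nonzero then
`F_d(p_k) ≤ (d(d-1))⁻¹ Σ_{i ≠ j} F₂(p_{k,i}, p_{k,j})`. [Kennedy–Lieb–Shastry 1988, after eq. (8)]
[cite: KLS1988PRL, after eq. (8)] -/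
theorem klsIntegrand_le_pairSum {d : ℕ} (hd : 2 ≤ d) (L : ℕ) [NeZero L] {k : TorusSite d L}
    (hk : ∀ i, k i ≠ 0) :
    klsIntegrand d (latticeMomentum L k) ≤
      (∑ ij ∈ (univ : Finset (Fin d)).offDiag,
          klsIntegrand 2 (latticeMomentum L ![k ij.1, k ij.2])) / ((d : ℝ) * (d - 1)) := by
  rw [klsIntegrand_eq_G (by omega)]
  have hc : ∀ i, Real.cos (latticeMomentum L k i) ∈ Set.Ico (-1 : ℝ) 1 := fun i =>
    ⟨Real.neg_one_le_cos _, cos_latticeMomentum_lt_one (hk i)⟩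
  refine (klsG_avg_le hd _ hc).trans (le_of_eq ?_)
  congr 1
  refine sum_congr rfl fun ij _ => ?_
  rw [klsIntegrand_two']
  simp only [latticeMomentum_apply, Matrix.cons_val_zero, Matrix.cons_val_one]

/-- **A priori bound at a point with a nonzero coordinate** `k_j`, `m = valMinAbs k_j`:
`F_d(p_k) ≤ [2d/(1 - cos p_{k,j})]^{1/2} ≤ √d · L/(2|m|)`, using `{·}₊ ≤ 1`, `Σᵢ(1 + cos) ≤ 2d`,
`Σᵢ(1 - cos) ≥ 1 - cos p_{k,j} ≥ (2/π²)(2πm/L)² = 8m²/L²`. [folklore] -/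
theorem klsIntegrand_le_of_ne_zero {d : ℕ} (L : ℕ) [NeZero L] (k : TorusSite d L) {j : Fin d}
    (hj : k j ≠ 0) :
    klsIntegrand d (latticeMomentum L k) ≤
      Real.sqrt d * L / 2 * (1 / |((k j).valMinAbs : ℝ)|) := by
  have hL : (0 : ℝ) < L := by exact_mod_cast Nat.pos_of_ne_zero (NeZero.ne L)
  set m : ℝ := ((k j).valMinAbs : ℝ) with hm_def
  have hm0 : m ≠ 0 := by
    have : (k j).valMinAbs ≠ 0 := fun h => hj ((ZMod.valMinAbs_eq_zero _).1 h)
    rw [hm_def]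
    exact_mod_cast this
  have hmabs : 0 < |m| := abs_pos.2 hm0
  -- `1 - cos p_j ≥ 8 m² / L²`
  have hcm : Real.cos (latticeMomentum L k j) = Real.cos (2 * Real.pi / L * m) := by
    rw [latticeMomentum_apply, cos_two_pi_val_div]
  have habs : |2 * Real.pi / L * m| ≤ Real.pi := by
    obtain ⟨h1, h2⟩ := valMinAbs_bounds L (k j)
    have hh : 0 < 2 * Real.pi / L := by positivity
    rw [abs_le]
    constructor
    · have h3 : 2 * Real.pi / L * (-(L : ℝ) / 2) = -Real.pi := by field_simp
      have h4 := mul_le_mul_of_nonneg_left (show (-(L : ℝ) / 2) ≤ m by linarith) hh.le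
      rwa [h3] at h4
    · have h3 : 2 * Real.pi / L * ((L : ℝ) / 2) = Real.pi := by field_simp
      have h4 := mul_le_mul_of_nonneg_left (show m ≤ (L : ℝ) / 2 by linarith) hh.le
      rwa [h3] at h4
  have hlow : 8 * m ^ 2 / (L : ℝ) ^ 2 ≤ 1 - Real.cos (latticeMomentum L k j) := by
    rw [hcm]
    have h1 := Real.cos_le_one_sub_mul_cos_sq habs
    have hx2 : 2 / Real.pi ^ 2 * (2 * Real.pi / L * m) ^ 2 = 8 * m ^ 2 / (L : ℝ) ^ 2 := by
      field_simp
      ring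
    linarith
  have h8 : 0 < 8 * m ^ 2 / (L : ℝ) ^ 2 := by positivity
  have hpos : 0 < 1 - Real.cos (latticeMomentum L k j) := h8.trans_le hlow
  have hnum : ∑ i, (1 + Real.cos (latticeMomentum L k i)) ≤ 2 * d :=
    calc ∑ i, (1 + Real.cos (latticeMomentum L k i)) ≤ ∑ _i : Fin d, (2 : ℝ) :=
          sum_le_sum fun i _ => by linarith [Real.cos_le_one (latticeMomentum L k i)]
      _ = 2 * d := by simp [mul_comm]
  have hden : 1 - Real.cos (latticeMomentum L k j) ≤
      ∑ i, (1 - Real.cos (latticeMomentum L k i)) :=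
    single_le_sum (f := fun i => 1 - Real.cos (latticeMomentum L k i))
      (fun i _ => sub_nonneg.2 (Real.cos_le_one _)) (mem_univ j)
  have hmax : max ((∑ i, Real.cos (latticeMomentum L k i)) / (d : ℝ)) 0 ≤ 1 := by
    refine max_le ?_ zero_le_one
    rcases Nat.eq_zero_or_pos d with hd | hd
    · subst hd; simp
    · rw [div_le_one (by exact_mod_cast hd)]
      calc ∑ i, Real.cos (latticeMomentum L k i) ≤ ∑ _i : Fin d, (1 : ℝ) :=
            sum_le_sum fun i _ => Real.cos_le_one _
        _ = d := by simp
  unfold klsIntegrand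
  calc Real.sqrt ((∑ i, (1 + Real.cos (latticeMomentum L k i))) /
          ∑ i, (1 - Real.cos (latticeMomentum L k i))) *
        max ((∑ i, Real.cos (latticeMomentum L k i)) / (d : ℝ)) 0
      ≤ Real.sqrt ((∑ i, (1 + Real.cos (latticeMomentum L k i))) /
          ∑ i, (1 - Real.cos (latticeMomentum L k i))) :=
        mul_le_of_le_one_right (Real.sqrt_nonneg _) hmax
    _ ≤ Real.sqrt (2 * d / (1 - Real.cos (latticeMomentum L k j))) := by
        refine Real.sqrt_le_sqrt ?_
        calc (∑ i, (1 + Real.cos (latticeMomentum L k i))) /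
              ∑ i, (1 - Real.cos (latticeMomentum L k i))
            ≤ 2 * d / ∑ i, (1 - Real.cos (latticeMomentum L k i)) :=
              div_le_div_of_nonneg_right hnum (hpos.le.trans hden)
          _ ≤ 2 * d / (1 - Real.cos (latticeMomentum L k j)) :=
              div_le_div_of_nonneg_left (by positivity) hpos hden
    _ ≤ Real.sqrt ((d : ℝ) * L ^ 2 / (4 * m ^ 2)) := by
        refine Real.sqrt_le_sqrt ?_
        calc 2 * (d : ℝ) / (1 - Real.cos (latticeMomentum L k j))
            ≤ 2 * d / (8 * m ^ 2 / (L : ℝ) ^ 2) := div_le_div_of_nonneg_left (by positivity) h8 hlow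
          _ = (d : ℝ) * L ^ 2 / (4 * m ^ 2) := by
              field_simp
              ring
    _ = Real.sqrt d * L / 2 * (1 / |m|) := by
        rw [← Real.sqrt_sq (show 0 ≤ Real.sqrt d * L / 2 * (1 / |m|) by positivity)]
        congr 1
        have hd0 : Real.sqrt (d : ℝ) ^ 2 = d := Real.sq_sqrt (Nat.cast_nonneg _)
        have hm2 : |m| ^ 2 = m ^ 2 := sq_abs m
        have h5 : (Real.sqrt d * L / 2 * (1 / |m|)) ^ 2 =
            Real.sqrt (d : ℝ) ^ 2 * (L : ℝ) ^ 2 / (4 * |m| ^ 2) := by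
          field_simp
          ring
        rw [h5, hd0, hm2]

/-- `Σ_{b ∈ ℤ_L ∖ 0} 1/|valMinAbs b| ≤ 2 H_L ≤ 2(1 + log L)`: `b ↦ |valMinAbs b|` is at most
two-to-one into `{1, …, L}`. [folklore] -/
theorem sum_inv_abs_valMinAbs_le (L : ℕ) [NeZero L] :
    ∑ b ∈ (univ : Finset (ZMod L)).erase 0, 1 / |(b.valMinAbs : ℝ)| ≤ 2 * (1 + Real.log L) := by
  classical
  set s : Finset (ZMod L) := (univ : Finset (ZMod L)).erase 0 with hs_def
  set φ : ZMod L → ℕ := fun b => b.valMinAbs.natAbs with hφ_def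
  have h1 : ∀ b ∈ s, 1 / |(b.valMinAbs : ℝ)| = (fun n : ℕ => ((n : ℝ))⁻¹) (φ b) := by
    intro b _
    simp only [hφ_def, one_div]
    rw [Nat.cast_natAbs, Int.cast_abs]
  rw [sum_congr rfl h1, sum_comp (fun n : ℕ => ((n : ℝ))⁻¹) φ]
  have hfib : ∀ n ∈ s.image φ, (s.filter (fun b => φ b = n)).card ≤ 2 := by
    intro n _
    refine (Finset.card_le_card (show s.filter (fun b => φ b = n) ⊆
      {((n : ℤ) : ZMod L), (((-n : ℤ)) : ZMod L)} from ?_)).trans card_le_two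
    intro b hb
    rw [mem_filter] at hb
    have h := Int.natAbs_eq b.valMinAbs
    have hn : b.valMinAbs.natAbs = n := hb.2
    rw [hn] at h
    rw [Finset.mem_insert, Finset.mem_singleton]
    rcases h with h | h
    · left; rw [← ZMod.coe_valMinAbs b, h]
    · right; rw [← ZMod.coe_valMinAbs b, h]
  have himage : s.image φ ⊆ Icc 1 L := by
    intro n hn
    obtain ⟨b, hb, rfl⟩ := mem_image.1 hn
    have hb0 : b ≠ 0 := (mem_erase.1 hb).1
    rw [Finset.mem_Icc]
    constructor
    · exact Int.natAbs_pos.2 fun h => hb0 ((ZMod.valMinAbs_eq_zero b).1 h)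
    · exact (ZMod.natAbs_valMinAbs_le b).trans (Nat.div_le_self L 2)
  calc ∑ n ∈ s.image φ, (s.filter (fun b => φ b = n)).card • ((n : ℝ))⁻¹
      ≤ ∑ n ∈ s.image φ, 2 • ((n : ℝ))⁻¹ :=
        sum_le_sum fun n hn => nsmul_le_nsmul_left (inv_nonneg.2 (Nat.cast_nonneg n)) (hfib n hn)
    _ = 2 * ∑ n ∈ s.image φ, ((n : ℝ))⁻¹ := by
        rw [mul_sum]
        exact sum_congr rfl fun n _ => by rw [nsmul_eq_mul, Nat.cast_ofNat]
    _ ≤ 2 * ∑ n ∈ Icc 1 L, ((n : ℝ))⁻¹ :=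
        mul_le_mul_of_nonneg_left (sum_le_sum_of_subset_of_nonneg himage
          fun n _ _ => inv_nonneg.2 (Nat.cast_nonneg n)) (by norm_num)
    _ = 2 * (harmonic L : ℝ) := by
        simp only [harmonic_eq_sum_Icc, Rat.cast_sum, Rat.cast_inv, Rat.cast_natCast]
    _ ≤ 2 * (1 + Real.log L) := by
        gcongr
        exact harmonic_le_one_add_log L

/-- **Interior part of the Riemann sum** (`d = e + 2 ≥ 2`): by Jensen over pairs of directions,
the counting `Σ_{k : k_i, k_j ≠ 0} f(k_i, k_j) = L^{d-2} Σ_{a, b ≠ 0} f(a, b)` and the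
two-dimensional cell bound, `Σ_{k : all k_i ≠ 0} F_d(p_k) ≤ (3√2/2π) L^d`.
[Kennedy–Lieb–Shastry 1988, after eq. (8)] [cite: KLS1988PRL, after eq. (8)] -/
theorem kls_interior_sum_le (e L : ℕ) [NeZero L] :
    ∑ k ∈ ((univ : Finset (TorusSite (e + 2) L)).erase 0).filter (fun k => ∀ i, k i ≠ 0),
        klsIntegrand (e + 2) (latticeMomentum L k) ≤
      3 * Real.sqrt 2 / (2 * Real.pi) * (L : ℝ) ^ (e + 2) := by
  classical
  have hL : (0 : ℝ) < L := by exact_mod_cast Nat.pos_of_ne_zero (NeZero.ne L)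
  set d : ℕ := e + 2 with hd_def
  have hd2 : 2 ≤ d := by omega
  have hdd : (0 : ℝ) < (d : ℝ) * (d - 1) := by
    have : (2 : ℝ) ≤ d := by exact_mod_cast hd2
    exact mul_pos (by linarith) (by linarith)
  set g : ZMod L → ZMod L → ℝ := fun a b =>
    if a ≠ 0 ∧ b ≠ 0 then klsIntegrand 2 (latticeMomentum L ![a, b]) else 0 with hg_def
  have hg0 : ∀ a b, 0 ≤ g a b := fun a b => by
    simp only [hg_def]
    split_ifs
    · exact klsIntegrand_nonneg _ _
    · exact le_rfl
  -- the two-dimensional sum, in the form `Σ_a Σ_b g a b`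
  have h2D : ∑ a, ∑ b, g a b ≤ 3 * Real.sqrt 2 / (2 * Real.pi) * (L : ℝ) ^ 2 := by
    have h1 : ∑ a, ∑ b, g a b = ∑ v : TorusSite 2 L, g (v 0) (v 1) := by
      have := sum_pi_apply_two (d := 0) (X := ZMod L) (i := 0) (j := 1) (by decide) g
      rw [pow_zero, one_smul] at this
      exact this.symm
    rw [h1, ← (show ∑ v ∈ (univ : Finset (TorusSite 2 L)).filter (fun v => ∀ i, v i ≠ 0),
        klsIntegrand 2 (latticeMomentum L v) = ∑ v : TorusSite 2 L, g (v 0) (v 1) from ?_)]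
    · exact kls_twoDim_sum_le L
    rw [sum_filter]
    refine sum_congr rfl fun v _ => ?_
    have hv : latticeMomentum L ![v 0, v 1] = latticeMomentum L v := by
      ext i
      fin_cases i <;> rfl
    simp only [hg_def, Fin.forall_fin_two, hv]
  -- pointwise Jensen
  have hpt : ∀ k ∈ ((univ : Finset (TorusSite d L)).erase 0).filter (fun k => ∀ i, k i ≠ 0),
      klsIntegrand d (latticeMomentum L k) ≤
        (∑ ij ∈ (univ : Finset (Fin d)).offDiag, g (k ij.1) (k ij.2)) / ((d : ℝ) * (d - 1)) := by
    intro k hk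
    have hk' : ∀ i, k i ≠ 0 := (mem_filter.1 hk).2
    refine (klsIntegrand_le_pairSum hd2 L hk').trans (le_of_eq ?_)
    congr 1
    refine sum_congr rfl fun ij _ => ?_
    simp only [hg_def]
    split_ifs with h
    · rfl
    · exact absurd ⟨hk' ij.1, hk' ij.2⟩ h
  have hcard : (((univ : Finset (Fin d)).offDiag).card : ℝ) = d * (d - 1) := by
    rw [offDiag_card, card_univ, Fintype.card_fin, Nat.cast_sub (Nat.le_mul_self d),
      Nat.cast_mul]
    ring
  calc ∑ k ∈ ((univ : Finset (TorusSite d L)).erase 0).filter (fun k => ∀ i, k i ≠ 0),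
        klsIntegrand d (latticeMomentum L k)
      ≤ ∑ k ∈ ((univ : Finset (TorusSite d L)).erase 0).filter (fun k => ∀ i, k i ≠ 0),
          (∑ ij ∈ (univ : Finset (Fin d)).offDiag, g (k ij.1) (k ij.2)) / ((d : ℝ) * (d - 1)) :=
        sum_le_sum hpt
    _ ≤ ∑ k : TorusSite d L,
          (∑ ij ∈ (univ : Finset (Fin d)).offDiag, g (k ij.1) (k ij.2)) / ((d : ℝ) * (d - 1)) :=
        sum_le_sum_of_subset_of_nonneg (fun _ _ => mem_univ _) fun k _ _ =>
          div_nonneg (sum_nonneg fun ij _ => hg0 _ _) hdd.le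
    _ = (∑ ij ∈ (univ : Finset (Fin d)).offDiag, ∑ k : TorusSite d L, g (k ij.1) (k ij.2)) /
          ((d : ℝ) * (d - 1)) := by
        rw [← sum_div, sum_comm]
    _ = (∑ _ij ∈ (univ : Finset (Fin d)).offDiag, (L : ℝ) ^ e * ∑ a, ∑ b, g a b) /
          ((d : ℝ) * (d - 1)) := by
        congr 1
        refine sum_congr rfl fun ij hij => ?_
        rw [sum_pi_apply_two (mem_offDiag.1 hij).2.2 g, ZMod.card, nsmul_eq_mul, Nat.cast_pow]
    _ = (L : ℝ) ^ e * ∑ a, ∑ b, g a b := by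
        have hd0 : (d : ℝ) ≠ 0 := by positivity
        have hd1 : (d : ℝ) - 1 ≠ 0 := by
          have : (2 : ℝ) ≤ d := by exact_mod_cast hd2
          linarith
        rw [sum_const, nsmul_eq_mul, hcard]
        field_simp
    _ ≤ (L : ℝ) ^ e * (3 * Real.sqrt 2 / (2 * Real.pi) * (L : ℝ) ^ 2) :=
        mul_le_mul_of_nonneg_left h2D (by positivity)
    _ = 3 * Real.sqrt 2 / (2 * Real.pi) * (L : ℝ) ^ (e + 2) := by ring

/-- **Boundary part of the Riemann sum** (`d = e + 2 ≥ 2`): the nonzero points with a vanishing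
coordinate contribute at most `d(d-1) L^{d-2} · (√d L/2) Σ_{b ≠ 0} 1/|valMinAbs b|
≤ d(d-1)√d L^{d-1}(1 + log L) = o(L^d)`. [folklore] -/
theorem kls_boundary_sum_le (e L : ℕ) [NeZero L] :
    ∑ k ∈ ((univ : Finset (TorusSite (e + 2) L)).erase 0).filter (fun k => ¬ ∀ i, k i ≠ 0),
        klsIntegrand (e + 2) (latticeMomentum L k) ≤
      ((e + 2 : ℕ) : ℝ) * ((e + 2 : ℕ) - 1) * Real.sqrt ((e + 2 : ℕ)) * (1 + Real.log L) *
        (L : ℝ) ^ (e + 1) := by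
  classical
  have hL : (0 : ℝ) < L := by exact_mod_cast Nat.pos_of_ne_zero (NeZero.ne L)
  set d : ℕ := e + 2 with hd_def
  set w : ZMod L → ℝ := fun b => Real.sqrt d * L / 2 * (1 / |(b.valMinAbs : ℝ)|) with hw_def
  have hw0 : ∀ b, 0 ≤ w b := fun b => by positivity
  set f : ZMod L → ZMod L → ℝ := fun a b => if a = 0 ∧ b ≠ 0 then w b else 0 with hf_def
  have hf0 : ∀ a b, 0 ≤ f a b := fun a b => by
    simp only [hf_def]
    split_ifs
    · exact hw0 _
    · exact le_rfl
  have hpt : ∀ k ∈ ((univ : Finset (TorusSite d L)).erase 0).filter (fun k => ¬ ∀ i, k i ≠ 0),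
      klsIntegrand d (latticeMomentum L k) ≤
        ∑ ij ∈ (univ : Finset (Fin d)).offDiag, f (k ij.1) (k ij.2) := by
    intro k hk
    rw [mem_filter, mem_erase] at hk
    obtain ⟨⟨hk0, -⟩, hki⟩ := hk
    push Not at hki
    obtain ⟨i, hi⟩ := hki
    obtain ⟨j, hj⟩ : ∃ j, k j ≠ 0 := Function.ne_iff.1 hk0
    have hij : i ≠ j := fun h => hj (h ▸ hi)
    have hfij : f (k i) (k j) = w (k j) := by
      simp only [hf_def]
      split_ifs with h
      · rfl
      · exact absurd ⟨hi, hj⟩ h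
    calc klsIntegrand d (latticeMomentum L k) ≤ f (k i) (k j) := by
          rw [hfij]
          exact klsIntegrand_le_of_ne_zero L k hj
      _ ≤ ∑ ij ∈ (univ : Finset (Fin d)).offDiag, f (k ij.1) (k ij.2) :=
          single_le_sum (f := fun ij : Fin d × Fin d => f (k ij.1) (k ij.2)) (a := (i, j))
            (fun ij _ => hf0 _ _) (mem_offDiag.2 ⟨Finset.mem_univ i, Finset.mem_univ j, hij⟩)
  have hcard : (((univ : Finset (Fin d)).offDiag).card : ℝ) = d * (d - 1) := by
    rw [offDiag_card, card_univ, Fintype.card_fin, Nat.cast_sub (Nat.le_mul_self d),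
      Nat.cast_mul]
    ring
  have hab : ∑ a, ∑ b, f a b = Real.sqrt d * L / 2 *
      ∑ b ∈ (univ : Finset (ZMod L)).erase 0, 1 / |(b.valMinAbs : ℝ)| := by
    have hfa : ∀ a b, a ≠ 0 → f a b = 0 := by
      intro a b ha
      simp only [hf_def]
      split_ifs with h
      · exact absurd h.1 ha
      · rfl
    have hf00 : f 0 0 = 0 := by
      simp only [hf_def]
      split_ifs with h
      · exact absurd rfl h.2
      · rfl
    have hf0b : ∀ b, b ≠ 0 → f 0 b = w b := by
      intro b hb
      simp only [hf_def]
      split_ifs with h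
      · rfl
      · exact absurd ⟨by trivial, hb⟩ h
    rw [Fintype.sum_eq_single (0 : ZMod L) (fun a ha => sum_eq_zero fun b _ => hfa a b ha),
      ← Finset.sum_erase _ hf00, mul_sum]
    exact sum_congr rfl fun b hb => by rw [hf0b b (mem_erase.1 hb).1]
  calc ∑ k ∈ ((univ : Finset (TorusSite d L)).erase 0).filter (fun k => ¬ ∀ i, k i ≠ 0),
        klsIntegrand d (latticeMomentum L k)
      ≤ ∑ k ∈ ((univ : Finset (TorusSite d L)).erase 0).filter (fun k => ¬ ∀ i, k i ≠ 0),
          ∑ ij ∈ (univ : Finset (Fin d)).offDiag, f (k ij.1) (k ij.2) := sum_le_sum hpt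
    _ ≤ ∑ k : TorusSite d L, ∑ ij ∈ (univ : Finset (Fin d)).offDiag, f (k ij.1) (k ij.2) :=
        sum_le_sum_of_subset_of_nonneg (fun _ _ => mem_univ _) fun k _ _ =>
          sum_nonneg fun ij _ => hf0 _ _
    _ = ∑ ij ∈ (univ : Finset (Fin d)).offDiag, ∑ k : TorusSite d L, f (k ij.1) (k ij.2) :=
        sum_comm
    _ = ∑ _ij ∈ (univ : Finset (Fin d)).offDiag, (L : ℝ) ^ e * ∑ a, ∑ b, f a b := by
        refine sum_congr rfl fun ij hij => ?_
        rw [sum_pi_apply_two (mem_offDiag.1 hij).2.2 f, ZMod.card, nsmul_eq_mul, Nat.cast_pow]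
    _ = (d : ℝ) * (d - 1) * (L : ℝ) ^ e * (Real.sqrt d * L / 2 *
          ∑ b ∈ (univ : Finset (ZMod L)).erase 0, 1 / |(b.valMinAbs : ℝ)|) := by
        rw [sum_const, nsmul_eq_mul, hcard, hab]
        ring
    _ ≤ (d : ℝ) * (d - 1) * (L : ℝ) ^ e * (Real.sqrt d * L / 2 * (2 * (1 + Real.log L))) := by
        have hdd : (0 : ℝ) ≤ (d : ℝ) * (d - 1) := by
          have : (2 : ℝ) ≤ d := by exact_mod_cast (show 2 ≤ d by omega)
          exact mul_nonneg (by linarith) (by linarith)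
        gcongr
        exact sum_inv_abs_valMinAbs_le L
    _ = (d : ℝ) * (d - 1) * Real.sqrt d * (1 + Real.log L) * (L : ℝ) ^ (e + 1) := by ring

/-- **The punctured Riemann sums are eventually below `1/√2`**: for `d ≥ 2` and every side `L`,
`R_L(d) ≤ 3√2/(2π) + d(d-1)√d (1 + log L)/L`, with `3√2/(2π) = 0.6752… < 0.69 < 1/√2 = 0.7071…`.
This is the finite-volume content of KLS's "passing from sums to integrals", the convexity bound
`I(d) ≤ I(2)` and the numerical value `I(2) = 0.65`, in the form consumed by
`kennedy_lieb_shastry_xy_ground_of_riemannSum_le`.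
[Kennedy–Lieb–Shastry 1988, before eq. (2) and after eq. (8)] [cite: KLS1988PRL, after eq. (8)] -/
theorem klsRiemannSum_le (e L : ℕ) [NeZero L] :
    klsRiemannSum (e + 2) L ≤ 3 * Real.sqrt 2 / (2 * Real.pi) +
      ((e + 2 : ℕ) : ℝ) * ((e + 2 : ℕ) - 1) * Real.sqrt ((e + 2 : ℕ)) * (1 + Real.log L) / L := by
  classical
  have hL : (0 : ℝ) < L := by exact_mod_cast Nat.pos_of_ne_zero (NeZero.ne L)
  rw [klsRiemannSum_of_neZero, ← sum_filter_add_sum_filter_not _ (fun k => ∀ i, k i ≠ 0),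
    add_div]
  have hI := kls_interior_sum_le e L
  have hB := kls_boundary_sum_le e L
  refine add_le_add ?_ ?_
  · rw [div_le_iff₀ (by positivity)]
    exact hI
  · rw [div_le_div_iff₀ (by positivity) hL, pow_succ, ← mul_assoc]
    exact mul_le_mul_of_nonneg_right hB hL.le

/-- `(1 + log L)/L → 0`. [folklore] -/
theorem tendsto_one_add_log_div_nat :
    Tendsto (fun L : ℕ => (1 + Real.log L) / (L : ℝ)) atTop (𝓝 0) := by
  have ha := Real.tendsto_pow_log_div_mul_add_atTop 1 0 1 one_ne_zero
  have hb : Tendsto (fun x : ℝ => x⁻¹) atTop (𝓝 0) := tendsto_inv_atTop_zero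
  have h := hb.add ha
  rw [add_zero] at h
  have h' : Tendsto (fun x : ℝ => (1 + Real.log x) / x) atTop (𝓝 0) := by
    refine h.congr' ?_
    filter_upwards [eventually_ne_atTop 0] with x hx
    rw [pow_one, one_mul, add_zero, add_div, inv_eq_one_div]
  exact h'.comp tendsto_natCast_atTop_atTop

/-- **(R'') Eventual bound on the Riemann sums**: for every `d ≥ 2` there is `ρ < 1/√2`
(namely `ρ = 0.69`) with `R_L(d) ≤ ρ` for all large `L`. [Kennedy–Lieb–Shastry 1988, after
eq. (8): "`½ I(d) ≤ ½ I(2) = 0.325 < S/√2`"] [cite: KLS1988PRL, after eq. (8)] -/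
theorem klsRiemannSum_eventually_le (d : ℕ) (hd : 2 ≤ d) :
    ∃ ρ : ℝ, ρ < Real.sqrt 2 / 2 ∧ ∀ᶠ L : ℕ in atTop, klsRiemannSum d L ≤ ρ := by
  obtain ⟨e, rfl⟩ : ∃ e, d = e + 2 := ⟨d - 2, by omega⟩
  refine ⟨69 / 100, ?_, ?_⟩
  · have hsqrt2 : (1.38 : ℝ) < Real.sqrt 2 := by
      rw [Real.lt_sqrt (by norm_num)]
      norm_num
    linarith
  · set C : ℝ := ((e + 2 : ℕ) : ℝ) * ((e + 2 : ℕ) - 1) * Real.sqrt ((e + 2 : ℕ)) with hC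
    have hlim : Tendsto (fun L : ℕ => C * ((1 + Real.log L) / (L : ℝ))) atTop (𝓝 (C * 0)) :=
      tendsto_one_add_log_div_nat.const_mul C
    rw [mul_zero] at hlim
    have h3 : 3 * Real.sqrt 2 / (2 * Real.pi) < 0.676 := by
      have hsqrt2 : Real.sqrt 2 < 1.4143 := by
        rw [Real.sqrt_lt' (by norm_num)]
        norm_num
      rw [div_lt_iff₀ (by positivity)]
      nlinarith [Real.pi_gt_d4]
    filter_upwards [hlim.eventually_lt_const (show (0 : ℝ) < 0.014 by norm_num),
      eventually_ne_atTop 0] with L hL hL0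
    haveI : NeZero L := ⟨hL0⟩
    have hR := klsRiemannSum_le e L
    have : C * ((1 + Real.log L) / (L : ℝ)) = C * (1 + Real.log L) / L := by ring
    rw [this] at hL
    linarith

end RiemannSum

end Hubbard

end Literature.MathematicalPhysics.QuantumLattice
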